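import Literature.Probability.LatticeModels.LayeredPlaneRotatorSlabReduction
import Literature.Probability.LatticeModels.PlaneRotatorOnsagerWindow
import HarnessLib

/-!
# The Onsager window of the LAYERED plane rotator: Aizenman–Simon's `k T_c/J ≤ 1/ln(1+√2)` survives a weak
# inter-layer coupling

Topic `Literature/Probability/LatticeModels`, namespace `Literature.Probability.LatticeModels` (declarations under
`PlaneRotator`). The classical layered XY model on a finite `Λ ⊂ ℤ³` (free boundary conditions, tree
`layeredXYCoupling β J∥ J⊥ Λ`: in-plane nearest-neighbour coupling `J∥`, stacking coupling `J⊥`, the "lattice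
anisotropy" `(J, J, εJ)` of L. L. Liu, H. E. Stanley, Phys. Rev. Lett. **29** (1972) 927 [LiuStanley1972]).

INPUTS, both theorems of the tree with standard axioms and no named fact:

* the TWO-DIMENSIONAL Onsager window (M. Aizenman, B. Simon, Phys. Lett. **76A** (1980) 281 [AizenmanSimon1980RotorIsing],
  eq. (2) `β_c^R ≥ 2β_c^I = ln(1+√2)`, with E. H. Lieb, Comm. Math. Phys. **77** (1980) 127 [Lieb1980], p. 128, the
  finite algorithm): `PlaneRotator.exists_nnBoxShellSum_lt_one_of_lt_log_one_add_sqrt_two` — for every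
  `0 ≤ K < log(1+√2)` there is a box radius `R ≥ 1` with Lieb's number `S_R(K) < 1`
  (`PlaneRotatorOnsagerWindow.lean`, from the exact planar-Ising solution);
* Lieb's algorithm with a SLAB `[−R,R]² × {−1,0,1}` as inside system for the layered model, reduced to two numbers of
  the two-dimensional box (`LayeredPlaneRotatorSlabReduction.lean`, `PlaneRotator.twoPoint_layered_le_pow_box2D`):
  `⟨cos(θ_a − θ_c)⟩_{Λ,β} ≤ (S_R(βJ∥) + βJ⊥·χ^{int}_R(βJ∥))^{max(⌊|Δ₀|/R⌋, ⌊|Δ₁|/R⌋, |Δ₂|)}`.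

Since `S_R(K₀) < 1` leaves room `1 − S_R(K₀) > 0` and `χ^{int}_R(K₀)` is a finite number of the same box, a
stacking coupling `βJ⊥ ≤ δ := (1 − S_R)/(2(χ^{int}_R + 1))` keeps the base below `(1 + S_R)/2 < 1`. Hence (this file):

* §1 `layeredXYCoupling_le_of_mul_le`, `twoPoint_layered_mono_of_mul_le` — Griffiths–Ginibre monotonicity in the
  dimensionless couplings `(βJ∥, βJ⊥)`;
* §2 **`exists_layered_slabBound_of_lt_log_one_add_sqrt_two`** — for every `0 ≤ K₀ < log(1+√2)` there are
  `R ≥ 1`, `δ > 0` and `s ∈ [½, 1)` such that for ALL `β, J∥, J⊥ ≥ 0` with `βJ∥ ≤ K₀` and `βJ⊥ ≤ δ`, every finite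
  `Λ ⊂ ℤ³` and `a, c ∈ Λ`: `⟨cos(θ_a − θ_c)⟩_{Λ,β} ≤ s^{max(⌊|a₀−c₀|/R⌋, ⌊|a₁−c₁|/R⌋, |a₂−c₂|)}`;
* §3 the two readable shapes: **`twoPoint_layered_exp_decay_of_lt_log_one_add_sqrt_two`** — exponential
  clustering `≤ C·e^{−m‖a−c‖_∞}` in ALL three directions, uniformly in the volume — and
  `twoPoint_layered_le_pow_layer_of_lt_log_one_add_sqrt_two` — geometric decay `s^{|ℓ(a) − ℓ(c)|}` across the layers
  (the conclusion shape of the layer-decoupling theorem `twoPoint_layered_le_pow_interlayer'`);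
* §4 the anisotropy and temperature forms: **`twoPoint_layered_exp_decay_of_anisotropy_le`** — for every
  `K₀ < log(1+√2)` there is `Δ₀ > 0` such that every layered model with anisotropy `0 ≤ J⊥/J∥ ≤ Δ₀` clusters
  exponentially whenever `βJ∥ ≤ K₀`; and `twoPoint_layered_exp_decay_of_temperature` — for `J∥ > 0` and every
  temperature `T` with `J∥ < T·log(1+√2)`, i.e. `T > J∥/ln(1+√2) = 1.1346·J∥` (tree decimal
  `inv_log_one_add_sqrt_two_lt`), there is `δ > 0` such that the model at `β = 1/T` clusters exponentially for every
  stacking coupling `0 ≤ J⊥ ≤ δ`.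

READING. With the critical point defined by the loss of exponential clustering (as in [AizenmanSimon1980RotorIsing]),
`limsup_{J⊥ → 0⁺} k_B T_c^{3D-XY}(J∥, J⊥) ≤ J∥/ln(1+√2) = 1.1346·J∥`: Aizenman–Simon's two-dimensional bound
`k T_c/J ≤ 1.13` is CONTINUOUS under switching on the third dimension weakly — the rigorous, one-sided form of the
quasi-two-dimensional crossover `T_c^{3D}(J⊥) ↓ T^{2D}` as `J⊥ → 0` (Liu–Stanley; the Kosterlitz–Thouless point
`0.89·J∥` [float] itself is out of reach of correlation-inequality methods). The threshold `δ(K₀)`, `Δ₀(K₀)` is NOT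
made explicit here (it comes from the exact-solution decay constants through Lieb's algorithm); the explicit,
certificate-backed points of the tree are `LayeredPlaneRotatorIsingCertificate.lean` (`k_BT ≥ 1.2523·J∥` for
`J⊥ ≤ J∥/4000`, `1.2878·J∥` for `J⊥ ≤ J∥/800`).

Cell use (`pub/hubbard-tc`, MO-S3 ORDER → `T_c` back-end, seat mod-1 «interlayer coupling ↦ 3D ordering»,
ASSUMPTIONS §1 keys K4-c/K5): the certified-currency interlayer transfer at the Onsager window — the XY-class
companion coefficient tends to `c/(2 ln(1+√2)) = 0.5673·c` as the anisotropy `Δ → 0` (from `c/(2 ln(50/23)) = 0.6439·c`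
at `Δ ≤ 1/800`). Classical effective model only; no `T_c` object; no Monte-Carlo constant; the universal-jump relation
is neither used nor proved.

## What this is not

Not a statement about any quantum or electronic model, nor about a material; no explicit `δ`; nothing at or near the
Kosterlitz–Thouless temperature; the lower side (`J⊥ > 0` RAISES the ordering temperature, Ginibre) is
`PlaneRotator.twoPoint_mono`, not here.
-/

noncomputable section

open MeasureTheory Finset Filter
open scoped BigOperators Topology

namespace Literature.Probability.LatticeModels

namespace PlaneRotator

open Literature.Barriers.CriticalPhenomena Literature.Barriers.CriticalPhenomena.LongRangeIsing

variable [MeasurableSpace Circle] [BorelSpace Circle]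

/-! ## §1 Monotonicity in the dimensionless couplings `(βJ∥, βJ⊥)` -/

omit [MeasurableSpace Circle] [BorelSpace Circle] in
/-- The layered couplings at `(β, J∥, J⊥)` are dominated by those at `(1, K∥, K⊥)` as soon as `βJ∥ ≤ K∥` and
`βJ⊥ ≤ K⊥`: only the products `βJ∥`, `βJ⊥` enter the Gibbs weight.
[cite: LiuStanley1972, p. 272 (layers (J, J, εJ))] -/
theorem layeredXYCoupling_le_of_mul_le {β Jp Jz Kp Kz : ℝ} (hp : β * Jp ≤ Kp)
    (hz : β * Jz ≤ Kz) (Λ : Finset (Site 3)) (p : Λ × Λ) :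
    layeredXYCoupling β Jp Jz Λ p ≤ layeredXYCoupling 1 Kp Kz Λ p := by
  unfold layeredXYCoupling layeredCoupling
  split_ifs
  · have h : β / 2 * Jp = (β * Jp) / 2 := by ring
    rw [h]; linarith
  · have h : β / 2 * Jz = (β * Jz) / 2 := by ring
    rw [h]; linarith
  · simp

/-- **Griffiths–Ginibre monotonicity in `(βJ∥, βJ⊥)`**: for `β, J∥, J⊥ ≥ 0` with `βJ∥ ≤ K∥`, `βJ⊥ ≤ K⊥`, every
two-point function of the layered model at `(β, J∥, J⊥)` is at most the one at `(1, K∥, K⊥)` (tree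
`PlaneRotator.twoPoint_mono`, Ginibre 1970). [cite: Ginibre1970, Thm. 3 / Cor. (monotonicity of correlations in ferromagnetic couplings)] -/
theorem twoPoint_layered_mono_of_mul_le {β Jp Jz Kp Kz : ℝ} (hβ : 0 ≤ β) (hp0 : 0 ≤ Jp) (hz0 : 0 ≤ Jz)
    (hp : β * Jp ≤ Kp) (hz : β * Jz ≤ Kz) (Λ : Finset (Site 3)) (a c : Λ) :
    twoPoint (layeredXYCoupling β Jp Jz Λ) a c ≤ twoPoint (layeredXYCoupling 1 Kp Kz Λ) a c :=
  twoPoint_mono (layeredXYCoupling_nonneg hβ hp0 hz0 Λ) (layeredXYCoupling_le_of_mul_le hp hz Λ) a c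

/-! ## §2 The window: one box radius, one stacking threshold, one base `< 1` -/

/-- **The Onsager window of the layered plane rotator (slab form).** For every `0 ≤ K₀ < log(1+√2)` there are a
box radius `R ≥ 1`, a threshold `δ > 0` and a base `½ ≤ s < 1` such that for ALL `β, J∥, J⊥ ≥ 0` with
`βJ∥ ≤ K₀` and `βJ⊥ ≤ δ`, every finite `Λ ⊂ ℤ³` (free boundary conditions) and `a, c ∈ Λ`:

  `⟨cos(θ_a − θ_c)⟩_{Λ,β} ≤ s ^ max(⌊|a₀ − c₀|/R⌋, ⌊|a₁ − c₁|/R⌋, |a₂ − c₂|)`.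

Proof: Lieb's algorithm terminates in the plane (`S_R(K₀) < 1` for some `R`, from the exact planar-Ising solution
via Aizenman–Simon), and the slab reduction bounds the layered model by `(S_R(K₀) + βJ⊥·χ^{int}_R(K₀))^{index}`;
take `δ = (1 − S_R)/(2(χ^{int}_R + 1))`, `s = (1 + S_R)/2`, and Griffiths–Ginibre to pass from `βJ∥ ≤ K₀` to `K₀`.
[cite: AizenmanSimon1980RotorIsing, eq. (2)] [cite: Lieb1980, eq. (23) and p. 128 (boxes; finite algorithm)]
[cite: LiuStanley1972, p. 272 (layers (J, J, εJ))] -/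
theorem exists_layered_slabBound_of_lt_log_one_add_sqrt_two {K₀ : ℝ} (hK0 : 0 ≤ K₀)
    (hK : K₀ < Real.log (1 + Real.sqrt 2)) :
    ∃ (R : ℕ) (δ s : ℝ), 1 ≤ R ∧ 0 < δ ∧ 1 / 2 ≤ s ∧ s < 1 ∧
      ∀ β Jp Jz : ℝ, 0 ≤ β → 0 ≤ Jp → 0 ≤ Jz → β * Jp ≤ K₀ → β * Jz ≤ δ →
        ∀ (Λ : Finset (Site 3)) (a c : Λ),
          twoPoint (layeredXYCoupling β Jp Jz Λ) a c ≤ s ^ aIndex (slabRadii R) ((a : Site 3) - (c : Site 3)) := by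
  obtain ⟨R, hR, hS⟩ := exists_nnBoxShellSum_lt_one_of_lt_log_one_add_sqrt_two hK0 hK
  set S : ℝ := nnBoxShellSum K₀ 2 R with hSdef
  set χ : ℝ := boxInteriorSum K₀ R with hχdef
  have hS0 : 0 ≤ S := boxShellSum_nonneg (fun x y => mul_nonneg (by positivity) (nnCoupling_nonneg _ _)) R
  have hχ0 : 0 ≤ χ := boxInteriorSum_nonneg hK0 R
  refine ⟨R, (1 - S) / (2 * (χ + 1)), (1 + S) / 2, hR, div_pos (by linarith) (by positivity), by linarith,
    by linarith, ?_⟩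
  intro β Jp Jz hβ hp hz hKp hKz Λ a c
  -- Griffiths–Ginibre: pass to the couplings `(1, K₀, βJ⊥)`
  have hmono := twoPoint_layered_mono_of_mul_le hβ hp hz hKp (le_refl (β * Jz)) Λ a c
  refine hmono.trans ?_
  -- the slab reduction at `(1, K₀, βJ⊥)`
  have hslab := twoPoint_layered_le_pow_box2D (β := 1) (Jp := K₀) (Jz := β * Jz) zero_le_one hK0
    (mul_nonneg hβ hz) hR Λ a c
  simp only [one_mul] at hslab
  refine hslab.trans (pow_le_pow_left₀ (add_nonneg hS0 (mul_nonneg (mul_nonneg hβ hz) hχ0)) ?_ _)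
  -- the base: `S + βJ⊥·χ ≤ S + δχ ≤ (1 + S)/2`
  have h1 : β * Jz * χ ≤ (1 - S) / (2 * (χ + 1)) * χ := mul_le_mul_of_nonneg_right hKz hχ0
  have h2 : (1 - S) / (2 * (χ + 1)) * χ ≤ (1 - S) / 2 := by
    rw [div_mul_eq_mul_div, div_le_div_iff₀ (by positivity) (by positivity)]
    nlinarith
  linarith

/-! ## §3 Exponential clustering in all directions; geometric decay across the layers -/

omit [MeasurableSpace Circle] [BorelSpace Circle] in
/-- The slab index dominates the `ℓ^∞` floor-distance: `⌊‖y‖_∞/R⌋ ≤ max(⌊|y₀|/R⌋, ⌊|y₁|/R⌋, |y₂|)` for `R ≥ 1`.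
[cite: Simon1980CMP, Thm 1.3 (exponential decay summed over the lattice)] -/
theorem supNorm_div_le_aIndex_slabRadii {R : ℕ} (hR : 1 ≤ R) (y : Site 3) :
    Site.supNorm y / R ≤ aIndex (slabRadii R) y := by
  obtain ⟨j, hj⟩ := Site.exists_natAbs_eq_supNorm Finset.univ_nonempty y
  rw [← hj]
  have hjR : slabRadii R j ≤ R := by fin_cases j <;> simp [slabRadii, hR]
  have hj1 : 0 < slabRadii R j := by fin_cases j <;> simp [slabRadii] <;> omega
  exact (Nat.div_le_div_left hjR hj1).trans (div_le_aIndex (slabRadii R) y j)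

omit [MeasurableSpace Circle] [BorelSpace Circle] in
/-- From a geometric bound in the slab index to an exponential bound in the `ℓ^∞` distance: for `½ ≤ s < 1` and
`R ≥ 1`, `s^{index(y)} ≤ s⁻¹ · exp(−(−log s / R)·‖y‖_∞)`. [cite: Simon1980CMP, Thm 1.3] -/
theorem pow_aIndex_slabRadii_le_exp {s : ℝ} (hs0 : 1 / 2 ≤ s) (hs1 : s < 1) {R : ℕ} (hR : 1 ≤ R) (y : Site 3) :
    s ^ aIndex (slabRadii R) y ≤ s⁻¹ * Real.exp (-(-Real.log s / R) * ‖y‖) := by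
  have hspos : 0 < s := by linarith
  have hlog : Real.log s < 0 := Real.log_neg hspos hs1
  set N : ℕ := Site.supNorm y with hN
  -- `s^{index} ≤ s^{⌊N/R⌋}`
  have h1 : s ^ aIndex (slabRadii R) y ≤ s ^ (N / R) :=
    pow_le_pow_of_le_one hspos.le hs1.le (supNorm_div_le_aIndex_slabRadii hR y)
  refine h1.trans ?_
  -- `⌊N/R⌋ ≥ N/R − 1`
  have hRpos : (0 : ℝ) < R := by exact_mod_cast (show 0 < R by omega)
  have hfloor : (N : ℝ) / R - 1 ≤ ((N / R : ℕ) : ℝ) := by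
    have h := Nat.lt_mul_div_succ N (show 0 < R by omega)
    have h' : (N : ℝ) < (R : ℝ) * (((N / R : ℕ) : ℝ) + 1) := by exact_mod_cast h
    rw [div_sub_one (ne_of_gt hRpos), div_le_iff₀ hRpos]
    nlinarith
  -- `s^k = exp(k log s) ≤ exp((N/R − 1) log s) = s⁻¹ exp((N/R) log s)`
  have hpow : s ^ (N / R) = Real.exp (((N / R : ℕ) : ℝ) * Real.log s) := by
    rw [Real.exp_nat_mul, Real.exp_log hspos]
  rw [hpow, Site.norm_eq_supNorm, ← hN]
  have hle : ((N / R : ℕ) : ℝ) * Real.log s ≤ ((N : ℝ) / R - 1) * Real.log s :=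
    mul_le_mul_of_nonpos_right hfloor hlog.le
  refine (Real.exp_le_exp.2 hle).trans (le_of_eq ?_)
  rw [sub_mul, one_mul, Real.exp_sub, Real.exp_log hspos, div_eq_mul_inv, mul_comm _ s⁻¹]
  congr 1
  congr 1
  field_simp

/-- **Aizenman–Simon eq. (2) for the layered plane rotator: exponential clustering in all three directions,
uniformly in the volume, throughout the Onsager window with a weak stacking coupling.** For every
`0 ≤ K₀ < log(1+√2)` there are `δ > 0`, `C > 0`, `m > 0` such that for all `β, J∥, J⊥ ≥ 0` with `βJ∥ ≤ K₀` and
`βJ⊥ ≤ δ`, every finite `Λ ⊂ ℤ³` and `a, c ∈ Λ`: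

  `⟨cos(θ_a − θ_c)⟩_{Λ,β} ≤ C · exp(−m·‖a − c‖_∞)`.

So, with `T_c` defined by the loss of exponential clustering, `k_B T_c^{3D-XY}(J∥, J⊥) ≤ J∥/K₀` whenever
`J⊥/T ≤ δ(K₀)`, for every `K₀ < ln(1+√2)`: `limsup_{J⊥→0} T_c(J∥, J⊥) ≤ J∥/ln(1+√2) = 1.1346·J∥`.
[cite: AizenmanSimon1980RotorIsing, eq. (2)] [cite: Lieb1980, p. 128 (boxes; finite algorithm)]
[cite: LiuStanley1972, p. 272 (layers (J, J, εJ))] -/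
theorem twoPoint_layered_exp_decay_of_lt_log_one_add_sqrt_two {K₀ : ℝ} (hK0 : 0 ≤ K₀)
    (hK : K₀ < Real.log (1 + Real.sqrt 2)) :
    ∃ δ C m : ℝ, 0 < δ ∧ 0 < C ∧ 0 < m ∧
      ∀ β Jp Jz : ℝ, 0 ≤ β → 0 ≤ Jp → 0 ≤ Jz → β * Jp ≤ K₀ → β * Jz ≤ δ →
        ∀ (Λ : Finset (Site 3)) (a c : Λ),
          twoPoint (layeredXYCoupling β Jp Jz Λ) a c ≤ C * Real.exp (-m * ‖(a : Site 3) - (c : Site 3)‖) := by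
  obtain ⟨R, δ, s, hR, hδ, hs0, hs1, hbound⟩ := exists_layered_slabBound_of_lt_log_one_add_sqrt_two hK0 hK
  have hspos : 0 < s := by linarith
  have hRpos : (0 : ℝ) < R := by exact_mod_cast (show 0 < R by omega)
  refine ⟨δ, s⁻¹, -Real.log s / R, hδ, inv_pos.2 hspos,
    div_pos (neg_pos.2 (Real.log_neg hspos hs1)) hRpos, ?_⟩
  intro β Jp Jz hβ hp hz hKp hKz Λ a c
  exact (hbound β Jp Jz hβ hp hz hKp hKz Λ a c).trans (pow_aIndex_slabRadii_le_exp hs0 hs1 hR _)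

/-- **Geometric decay across the layers** (the shape of the layer-decoupling bound
`twoPoint_layered_le_pow_interlayer'`, now with NO susceptibility input): for every `0 ≤ K₀ < log(1+√2)` there are
`δ > 0` and `0 ≤ s < 1` such that for all `β, J∥, J⊥ ≥ 0` with `βJ∥ ≤ K₀`, `βJ⊥ ≤ δ`, every finite `Λ ⊂ ℤ³` and
`a, c ∈ Λ`: `⟨cos(θ_a − θ_c)⟩_{Λ,β} ≤ s^{|ℓ(a) − ℓ(c)|}` — «no three-dimensional order at `k_BT ≥ J∥/K₀` for
`J⊥ ≤ δ·k_BT`». [cite: Lieb1980, eq. (23) and notes added in proof (2)] [cite: AizenmanSimon1980RotorIsing, eq. (2)] -/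
theorem twoPoint_layered_le_pow_layer_of_lt_log_one_add_sqrt_two {K₀ : ℝ} (hK0 : 0 ≤ K₀)
    (hK : K₀ < Real.log (1 + Real.sqrt 2)) :
    ∃ δ s : ℝ, 0 < δ ∧ 0 ≤ s ∧ s < 1 ∧
      ∀ β Jp Jz : ℝ, 0 ≤ β → 0 ≤ Jp → 0 ≤ Jz → β * Jp ≤ K₀ → β * Jz ≤ δ →
        ∀ (Λ : Finset (Site 3)) (a c : Λ),
          twoPoint (layeredXYCoupling β Jp Jz Λ) a c ≤ s ^ (((a : Site 3) - (c : Site 3)) 2).natAbs := by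
  obtain ⟨R, δ, s, hR, hδ, hs0, hs1, hbound⟩ := exists_layered_slabBound_of_lt_log_one_add_sqrt_two hK0 hK
  refine ⟨δ, s, hδ, by linarith, hs1, fun β Jp Jz hβ hp hz hKp hKz Λ a c => ?_⟩
  refine (hbound β Jp Jz hβ hp hz hKp hKz Λ a c).trans (pow_le_pow_of_le_one (by linarith) hs1.le ?_)
  have h := div_le_aIndex (slabRadii R) ((a : Site 3) - (c : Site 3)) 2
  simpa [slabRadii] using h

/-! ## §4 The anisotropy form and the temperature form -/

/-- **Anisotropy form.** For every `0 ≤ K₀ < log(1+√2)` there are `Δ₀ > 0`, `C > 0`, `m > 0` such that the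
layered XY model with ANY anisotropy `0 ≤ Δ := J⊥/J∥ ≤ Δ₀` clusters exponentially in all directions, uniformly in
the volume, at every `(β, J∥)` with `β, J∥ ≥ 0`, `βJ∥ ≤ K₀`:
`⟨cos(θ_a − θ_c)⟩_{Λ; β, J∥, ΔJ∥} ≤ C·exp(−m‖a − c‖_∞)`. Reading: `k_B T_c^{3D-XY}(J∥, ΔJ∥) ≤ J∥/K₀` for all
`Δ ≤ Δ₀(K₀)`, with `J∥/K₀ ↓ J∥/ln(1+√2) = 1.1346·J∥` as `K₀ ↑ ln(1+√2)` — the one-sided, theorem-grade form of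
the quasi-two-dimensional crossover `T_c^{3D}(Δ) → T^{2D}` (`Δ → 0`). [cite: LiuStanley1972, p. 272 (layers (J, J, εJ))]
[cite: AizenmanSimon1980RotorIsing, eq. (2)] -/
theorem twoPoint_layered_exp_decay_of_anisotropy_le {K₀ : ℝ} (hK0 : 0 ≤ K₀)
    (hK : K₀ < Real.log (1 + Real.sqrt 2)) :
    ∃ Δ₀ C m : ℝ, 0 < Δ₀ ∧ 0 < C ∧ 0 < m ∧
      ∀ Δ β Jp : ℝ, 0 ≤ Δ → Δ ≤ Δ₀ → 0 ≤ β → 0 ≤ Jp → β * Jp ≤ K₀ →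
        ∀ (Λ : Finset (Site 3)) (a c : Λ),
          twoPoint (layeredXYCoupling β Jp (Δ * Jp) Λ) a c ≤ C * Real.exp (-m * ‖(a : Site 3) - (c : Site 3)‖) := by
  obtain ⟨δ, C, m, hδ, hC, hm, hbound⟩ := twoPoint_layered_exp_decay_of_lt_log_one_add_sqrt_two hK0 hK
  refine ⟨δ / (K₀ + 1), C, m, div_pos hδ (by linarith), hC, hm, ?_⟩
  intro Δ β Jp hΔ0 hΔ hβ hp hKp Λ a c
  refine hbound β Jp (Δ * Jp) hβ hp (mul_nonneg hΔ0 hp) hKp ?_ Λ a c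
  -- `β(ΔJ∥) = Δ·(βJ∥) ≤ Δ₀·K₀ ≤ δ`
  have h1 : β * (Δ * Jp) = Δ * (β * Jp) := by ring
  rw [h1]
  calc Δ * (β * Jp) ≤ δ / (K₀ + 1) * K₀ :=
        mul_le_mul hΔ hKp (mul_nonneg hβ hp) (div_nonneg hδ.le (by linarith))
    _ ≤ δ := by
        rw [div_mul_eq_mul_div, div_le_iff₀ (by linarith)]
        nlinarith

/-- **Temperature form.** Let `J∥ > 0` and let `T` be a temperature with `J∥ < T·log(1+√2)`, i.e.
`k_BT > J∥/ln(1+√2)` (`≤ 1.1346·J∥`, tree `inv_log_one_add_sqrt_two_lt`). Then there are `δ > 0`, `C > 0`,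
`m > 0` such that for EVERY stacking coupling `0 ≤ J⊥ ≤ δ` the layered XY model at inverse temperature `β = 1/T`
clusters exponentially in all directions, uniformly in the volume:
`⟨cos(θ_a − θ_c)⟩_{Λ, 1/T} ≤ C·exp(−m‖a − c‖_∞)` — «no order above Aizenman–Simon's `1.13·J∥` for a weak enough
third dimension». [cite: AizenmanSimon1980RotorIsing, eq. (2)] [cite: LiuStanley1972, p. 272 (layers (J, J, εJ))] -/
theorem twoPoint_layered_exp_decay_of_temperature {Jp T : ℝ} (hp : 0 < Jp) (hT : 0 < T)
    (hwin : Jp < T * Real.log (1 + Real.sqrt 2)) :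
    ∃ δ C m : ℝ, 0 < δ ∧ 0 < C ∧ 0 < m ∧
      ∀ Jz : ℝ, 0 ≤ Jz → Jz ≤ δ →
        ∀ (Λ : Finset (Site 3)) (a c : Λ),
          twoPoint (layeredXYCoupling (1 / T) Jp Jz Λ) a c ≤ C * Real.exp (-m * ‖(a : Site 3) - (c : Site 3)‖) := by
  have hK0 : 0 ≤ Jp / T := div_nonneg hp.le hT.le
  have hK : Jp / T < Real.log (1 + Real.sqrt 2) := by rw [div_lt_iff₀ hT]; linarith
  obtain ⟨δ, C, m, hδ, hC, hm, hbound⟩ := twoPoint_layered_exp_decay_of_lt_log_one_add_sqrt_two hK0 hK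
  refine ⟨δ * T, C, m, mul_pos hδ hT, hC, hm, fun Jz hz0 hz Λ a c => ?_⟩
  refine hbound (1 / T) Jp Jz (by positivity) hp.le hz0 (le_of_eq (by ring)) ?_ Λ a c
  rw [one_div_mul_eq_div, div_le_iff₀ hT]
  exact hz

end PlaneRotator

end Literature.Probability.LatticeModels
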